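import Summits.CriticalPhenomena.PercolationContinuityZ3.Theorems.PercNearOneGluingNoHeavyLowerTailSahiCoSingletonFubini
import Mathlib.Tactic.Linarith
import Mathlib.Tactic.Ring
import Mathlib.Tactic.Positivity
import HarnessLib

/-!
# Quantitative Harris inequality with an explicit size constant: ordered coordinate peeling
# (`Cov(f,g) ≥ Σ_t (Π_{s<t} q̄_{j_s})·J_{j_t}(f,g)`, hence `Cov ≥ (1/|E|)·Σ_j J_j`)

Support file (`--supports stmt-CriticalPhenomena-4575`), prover seat `prim-rate-mine-2` (lane prim-rate, constants-miner (c), BENCH row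
M2-R1, REF-SIGNED by prim-rate-mine-ref 2026-08-21).  No named facts, no sorries; standard axioms.

Setting: a finite index type `ι` (the edges), the product weight `prodWeight q` on the cube `ι → Bool` with biases `q_j ∈ [0,1]`
(`SahiSubsetChord.prodWeight`, = `Literature…coinWeight`), nonnegative monotone `f, g : (ι → Bool) → ℝ`, and for a coordinate `j`
* `pivDiff j f (x) = f(x^{j→1}) − f(x^{j→0})` (the pivotal increment, `≥ 0`),
* `coinfluence q j f g = q_j(1−q_j)·E[pivDiff j f · pivDiff j g]` — the JOINT INFLUENCE of `j` (for events: `q_j(1−q_j)·P(j pivotal for both)`);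
  `coinfluence_eq_sum_hi_lo` identifies it with the left side of the tree's one-coordinate theorem `SahiCoSingleton.coinfluence_le_sahiE_two`
  (`Cov(f,g) ≥ J_j(f,g)` for EVERY single `j`: law of total covariance + Harris),
* `q̄_j := min(q_j, 1−q_j)`.

**Theorem (ordered peeling, `peelSum_le_cov`).**  For every list `j_1, …, j_k` of DISTINCT coordinates,
  `Σ_{t ≤ k} (Π_{s<t} q̄_{j_s}) · J_{j_t}(f,g) ≤ Cov(f,g) = E(fg) − E f·E g`   (`= E₂(f,g)`, `peelSum_le_sahiE_two`).
Proof: `Cov(f,g) = J_j(f,g) + Cov(E_j f, E_j g)` with `E_j` the conditional average over coordinate `j` (`cov_eq_coinfluence_add_cov_condAvg`),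
and the one new inequality `J_i(E_j f, E_j g) ≥ q̄_j · J_i(f,g)` for `i ≠ j` (`min_mul_coinfluence_le_coinfluence_condAvg`: pointwise
`(q a₁ + (1−q) a₀)(q b₁ + (1−q) b₀) ≥ q̄·(q a₁b₁ + (1−q) a₀b₀)` for nonnegative increments); induct along the list, Harris at the end.

**Corollary (explicit size constant, `sum_coinfluence_le_card_mul_cov`).**  `Σ_j J_j(f,g) ≤ |ι| · Cov(f,g)`, i.e.
`Cov(f,g) ≥ (1/|E|)·Σ_e p_e(1−p_e)·E[Δ_e f Δ_e g]` — the Harris step at the bottom of every CSH / (S5) / GEN margin with the size of the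
box entering only through `1/|E|`.  For i.i.d. biases `q` the list form gives the coefficient `q̄^{t−1}` to the `t`-th coordinate; averaging
over the cyclic rotations of one enumeration yields the constant `(1−q̄^m)/(m(1−q̄))` (`= (2/m)(1−2^{−m})` at `q = ½`), which is ATTAINED by
`f = g = Π_e x_e` (AND) for `q ≤ ½` — so the list theorem is sharp and `1/|E|` is sharp up to the factor `(1−q̄^m)/(1−q̄) < 2`.
Negative companion (lane census, exact): no constant of the form `1/(#vertices − 1)` holds for connection events of bond percolation
(K₄ with unequal near-one weights), so `1/|E|` is the honest «box-size» constant.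
In print the quantitative Harris/Talagrand bounds are in terms of PRODUCTS of influences with unnamed universal constants
(Talagrand 1996; Keller–Mossel–Sen 2014; Kalai–Keller–Mossel 2016, arXiv:1511.04600 Thm 1.3–1.7) — incomparable with the present explicit form.
[cite: Harris1960, Lemma 4.1 (p. 16)] [cite: FortuinKasteleynGinibre1971, Prop. 1 (p. 91)]
-/

namespace Summit.CriticalPhenomena.PercolationContinuityZ3.Theorems

namespace QuantHarris

open Finset Literature.Combinatorics.Sahi2008 SahiSubsetChord SahiCoSingleton

variable {ι : Type*} [Fintype ι] [DecidableEq ι]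

/-! ### Definitions -/

/-- The pivotal increment of `f` at coordinate `j`: `D_j f(x) = f(x^{j→1}) − f(x^{j→0})` (does not depend on `x_j`). [this file] -/
def pivDiff (j : ι) (f : (ι → Bool) → ℝ) : (ι → Bool) → ℝ :=
  fun x => f (Function.update x j true) - f (Function.update x j false)

/-- The conditional average over coordinate `j`: `E_j f(x) = q_j f(x^{j→1}) + (1−q_j) f(x^{j→0})`. [this file] -/
def condAvg (q : ι → ℝ) (j : ι) (f : (ι → Bool) → ℝ) : (ι → Bool) → ℝ :=
  fun x => q j * f (Function.update x j true) + (1 - q j) * f (Function.update x j false)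

/-- The joint influence (coinfluence) of coordinate `j` for the pair `(f,g)`: `J_j(f,g) = q_j(1−q_j)·E[D_j f · D_j g]`. [this file] -/
def coinfluence (q : ι → ℝ) (j : ι) (f g : (ι → Bool) → ℝ) : ℝ :=
  q j * (1 - q j) * ex (prodWeight q) (pivDiff j f * pivDiff j g)

/-- The ordered peeling sum of a list of coordinates: `peelSum [j₁,…,j_k] = Σ_t (Π_{s<t} min(q_{j_s},1−q_{j_s}))·J_{j_t}(f,g)`,
defined by `peelSum [] = 0`, `peelSum (j :: L) = J_j(f,g) + min(q_j,1−q_j)·peelSum L`. [this file] -/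
def peelSum (q : ι → ℝ) (f g : (ι → Bool) → ℝ) : List ι → ℝ
  | [] => 0
  | j :: L => coinfluence q j f g + min (q j) (1 - q j) * peelSum q f g L

/-- `peelSum` on the empty list. [this file] -/
@[simp] theorem peelSum_nil (q : ι → ℝ) (f g : (ι → Bool) → ℝ) : peelSum q f g [] = 0 := rfl

/-- `peelSum` on a cons. [this file] -/
@[simp] theorem peelSum_cons (q : ι → ℝ) (f g : (ι → Bool) → ℝ) (j : ι) (L : List ι) :
    peelSum q f g (j :: L) = coinfluence q j f g + min (q j) (1 - q j) * peelSum q f g L := rfl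

/-! ### `hi` / `lo` versus `Function.update` -/

/-- Setting coordinate `j` of `lo j v` to `true` gives `hi j v`. [this file] -/
theorem update_lo_true (j : ι) (v : {i // i ∈ (univ : Finset ι).erase j} → Bool) :
    Function.update (lo j v) j true = hi j v := by
  funext i
  rcases eq_or_ne i j with rfl | h
  · rw [Function.update_self, hi_apply_self]
  · have hm : i ∈ (univ : Finset ι).erase j := Finset.mem_erase.mpr ⟨h, Finset.mem_univ i⟩
    rw [Function.update_of_ne h, lo_apply_mem j v hm, hi_apply_mem j v hm]

/-- Setting coordinate `j` of `hi j v` to `false` gives `lo j v`. [this file] -/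
theorem update_hi_false (j : ι) (v : {i // i ∈ (univ : Finset ι).erase j} → Bool) :
    Function.update (hi j v) j false = lo j v := by
  funext i
  rcases eq_or_ne i j with rfl | h
  · rw [Function.update_self, lo_apply_self]
  · have hm : i ∈ (univ : Finset ι).erase j := Finset.mem_erase.mpr ⟨h, Finset.mem_univ i⟩
    rw [Function.update_of_ne h, lo_apply_mem j v hm, hi_apply_mem j v hm]

/-- Setting coordinate `j` of `hi j v` to `true` changes nothing. [this file] -/
theorem update_hi_true (j : ι) (v : {i // i ∈ (univ : Finset ι).erase j} → Bool) :
    Function.update (hi j v) j true = hi j v := by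
  funext i
  rcases eq_or_ne i j with rfl | h
  · rw [Function.update_self, hi_apply_self]
  · rw [Function.update_of_ne h]

/-- Setting coordinate `j` of `lo j v` to `false` changes nothing. [this file] -/
theorem update_lo_false (j : ι) (v : {i // i ∈ (univ : Finset ι).erase j} → Bool) :
    Function.update (lo j v) j false = lo j v := by
  funext i
  rcases eq_or_ne i j with rfl | h
  · rw [Function.update_self, lo_apply_self]
  · rw [Function.update_of_ne h]

/-! ### Elementary properties of `pivDiff` and `condAvg` -/

omit [Fintype ι] in
/-- Pivotal increments of a monotone function are nonnegative. [this file] -/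
theorem pivDiff_nonneg {f : (ι → Bool) → ℝ} (hf : Monotone f) (j : ι) (x : ι → Bool) : 0 ≤ pivDiff j f x := by
  unfold pivDiff
  have hle : Function.update x j false ≤ Function.update x j true := by
    intro i
    rcases eq_or_ne i j with rfl | h
    · rw [Function.update_self, Function.update_self]; exact Bool.false_lt_true.le
    · rw [Function.update_of_ne h, Function.update_of_ne h]
  linarith [hf hle]

omit [Fintype ι] in
/-- The conditional average of a nonnegative function is nonnegative. [this file] -/
theorem condAvg_nonneg {q : ι → ℝ} (hq : ∀ i, 0 ≤ q i ∧ q i ≤ 1) {f : (ι → Bool) → ℝ} (hf : ∀ x, 0 ≤ f x)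
    (j : ι) (x : ι → Bool) : 0 ≤ condAvg q j f x := by
  unfold condAvg
  have h1 := (hq j).1; have h2 := (hq j).2
  have := hf (Function.update x j true); have := hf (Function.update x j false)
  positivity

omit [Fintype ι] in
/-- The conditional average of a monotone function is monotone. [this file] -/
theorem condAvg_mono {q : ι → ℝ} (hq : ∀ i, 0 ≤ q i ∧ q i ≤ 1) {f : (ι → Bool) → ℝ} (hf : Monotone f) (j : ι) :
    Monotone (condAvg q j f) := by
  intro x y hxy
  unfold condAvg
  have h1 := (hq j).1; have h2 := (hq j).2
  have hu : ∀ b : Bool, Function.update x j b ≤ Function.update y j b := by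
    intro b i
    rcases eq_or_ne i j with rfl | h
    · rw [Function.update_self, Function.update_self]
    · rw [Function.update_of_ne h, Function.update_of_ne h]; exact hxy i
  have a1 := hf (hu true); have a0 := hf (hu false)
  nlinarith [a1, a0, h1, h2]

omit [Fintype ι] in
/-- `E_j(fg) = E_j f · E_j g + q_j(1−q_j)·D_j f·D_j g` pointwise. [this file] -/
theorem condAvg_mul (q : ι → ℝ) (j : ι) (f g : (ι → Bool) → ℝ) (x : ι → Bool) :
    condAvg q j (f * g) x = condAvg q j f x * condAvg q j g x + q j * (1 - q j) * (pivDiff j f x * pivDiff j g x) := by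
  simp only [condAvg, pivDiff, Pi.mul_apply]
  ring

omit [Fintype ι] in
/-- `D_i` and `E_j` commute for `i ≠ j`. [this file] -/
theorem pivDiff_condAvg (q : ι → ℝ) {i j : ι} (h : i ≠ j) (f : (ι → Bool) → ℝ) :
    pivDiff i (condAvg q j f) = condAvg q j (pivDiff i f) := by
  funext x
  simp only [pivDiff, condAvg, Function.update_comm h]
  ring

/-! ### The product weight: expectation identities -/

/-- Averaging over a coordinate does not change the expectation: `E[E_j h] = E[h]`. [this file] -/
theorem ex_condAvg (q : ι → ℝ) (j : ι) (h : (ι → Bool) → ℝ) :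
    ex (prodWeight q) (condAvg q j h) = ex (prodWeight q) h := by
  rw [ex_eq_hi_lo q j (condAvg q j h), ex_eq_hi_lo q j h]
  simp only [condAvg, update_hi_true, update_hi_false, update_lo_true, update_lo_false]
  rw [Finset.mul_sum, Finset.mul_sum, Finset.mul_sum, Finset.mul_sum, ← Finset.sum_add_distrib, ← Finset.sum_add_distrib]
  refine Finset.sum_congr rfl fun v _ => ?_
  ring

/-- The expectation of `D_j f · D_j g` is the `hi/lo` section sum of the tree's one-coordinate theorem. [this file] -/
theorem ex_pivDiff_mul_eq_sum (q : ι → ℝ) (j : ι) (f g : (ι → Bool) → ℝ) :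
    ex (prodWeight q) (pivDiff j f * pivDiff j g)
      = ∑ v : ({i // i ∈ (univ : Finset ι).erase j} → Bool),
          prodWeight (fun i : {i // i ∈ (univ : Finset ι).erase j} => q i) v *
            ((f (hi j v) - f (lo j v)) * (g (hi j v) - g (lo j v))) := by
  rw [ex_eq_hi_lo q j]
  simp only [Pi.mul_apply, pivDiff, update_hi_true, update_hi_false, update_lo_true, update_lo_false]
  ring

/-- **Bridge to the tree's one-coordinate theorem**: `coinfluence q j f g` is exactly the left side of
`SahiCoSingleton.coinfluence_le_sahiE_two`. [this file] -/
theorem coinfluence_eq_sum_hi_lo (q : ι → ℝ) (j : ι) (f g : (ι → Bool) → ℝ) :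
    coinfluence q j f g
      = q j * (1 - q j) * ∑ v : ({i // i ∈ (univ : Finset ι).erase j} → Bool),
          prodWeight (fun i : {i // i ∈ (univ : Finset ι).erase j} => q i) v *
            ((f (hi j v) - f (lo j v)) * (g (hi j v) - g (lo j v))) := by
  rw [coinfluence, ex_pivDiff_mul_eq_sum]

/-- **Law of total covariance along one coordinate** (exact): `Cov(f,g) = J_j(f,g) + Cov(E_j f, E_j g)`. [this file] -/
theorem cov_eq_coinfluence_add_cov_condAvg (q : ι → ℝ) (j : ι) (f g : (ι → Bool) → ℝ) :
    ex (prodWeight q) (f * g) - ex (prodWeight q) f * ex (prodWeight q) g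
      = coinfluence q j f g
        + (ex (prodWeight q) (condAvg q j f * condAvg q j g)
            - ex (prodWeight q) (condAvg q j f) * ex (prodWeight q) (condAvg q j g)) := by
  have hfg : ex (prodWeight q) (f * g)
      = ex (prodWeight q) (condAvg q j f * condAvg q j g) + q j * (1 - q j) * ex (prodWeight q) (pivDiff j f * pivDiff j g) := by
    rw [← ex_condAvg q j (f * g)]
    have hfun : condAvg q j (f * g) = condAvg q j f * condAvg q j g + (q j * (1 - q j)) • (pivDiff j f * pivDiff j g) := by
      funext x
      simp only [Pi.add_apply, Pi.mul_apply, Pi.smul_apply, smul_eq_mul]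
      rw [condAvg_mul]
    rw [hfun, ex_add, ex_smul]
  rw [hfg, ex_condAvg, ex_condAvg, coinfluence]
  ring

/-! ### The one new inequality: averaging a coordinate costs at most the factor `min(q_j, 1 − q_j)` on every other joint influence -/

/-- Pointwise mixing inequality: for `0 ≤ q ≤ 1` and nonnegative `a₁, a₀, b₁, b₀`,
`min(q,1−q)·(q a₁b₁ + (1−q) a₀b₀) ≤ (q a₁ + (1−q) a₀)(q b₁ + (1−q) b₀)`. [this file] -/
theorem min_mul_mix_le {q a₁ a₀ b₁ b₀ : ℝ} (hq0 : 0 ≤ q) (hq1 : q ≤ 1)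
    (ha₁ : 0 ≤ a₁) (ha₀ : 0 ≤ a₀) (hb₁ : 0 ≤ b₁) (hb₀ : 0 ≤ b₀) :
    min q (1 - q) * (q * (a₁ * b₁) + (1 - q) * (a₀ * b₀))
      ≤ (q * a₁ + (1 - q) * a₀) * (q * b₁ + (1 - q) * b₀) := by
  have hm1 : min q (1 - q) ≤ q := min_le_left _ _
  have hm2 : min q (1 - q) ≤ 1 - q := min_le_right _ _
  have hm0 : 0 ≤ min q (1 - q) := le_min hq0 (by linarith)
  have hq1' : 0 ≤ 1 - q := by linarith
  have h1 : min q (1 - q) * (q * (a₁ * b₁)) ≤ q * (q * (a₁ * b₁)) :=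
    mul_le_mul_of_nonneg_right hm1 (by positivity)
  have h2 : min q (1 - q) * ((1 - q) * (a₀ * b₀)) ≤ (1 - q) * ((1 - q) * (a₀ * b₀)) :=
    mul_le_mul_of_nonneg_right hm2 (by positivity)
  have h3 : 0 ≤ q * (1 - q) * (a₁ * b₀ + a₀ * b₁) := by positivity
  nlinarith [h1, h2, h3]

/-- **Step 2 of the peeling**: for `i ≠ j` and monotone `f, g`,
`min(q_j, 1−q_j)·J_i(f,g) ≤ J_i(E_j f, E_j g)`. [this file] -/
theorem min_mul_coinfluence_le_coinfluence_condAvg {q : ι → ℝ} (hq : ∀ i, 0 ≤ q i ∧ q i ≤ 1)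
    {i j : ι} (h : i ≠ j) {f g : (ι → Bool) → ℝ} (hf : Monotone f) (hg : Monotone g) :
    min (q j) (1 - q j) * coinfluence q i f g ≤ coinfluence q i (condAvg q j f) (condAvg q j g) := by
  unfold coinfluence
  rw [pivDiff_condAvg q h f, pivDiff_condAvg q h g]
  have hqi : 0 ≤ q i * (1 - q i) := mul_nonneg (hq i).1 (by linarith [(hq i).2])
  -- pointwise: min · E_j(D_i f · D_i g) ≤ E_j(D_i f) · E_j(D_i g)
  have hpt : ∀ x, (min (q j) (1 - q j) • condAvg q j (pivDiff i f * pivDiff i g)) x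
      ≤ (condAvg q j (pivDiff i f) * condAvg q j (pivDiff i g)) x := by
    intro x
    simp only [Pi.smul_apply, Pi.mul_apply, smul_eq_mul, condAvg]
    exact min_mul_mix_le (hq j).1 (hq j).2 (pivDiff_nonneg hf i _) (pivDiff_nonneg hf i _)
      (pivDiff_nonneg hg i _) (pivDiff_nonneg hg i _)
  have hmono := ex_mono (μ := prodWeight q) (SahiSubsetChord.prodWeight_nonneg hq) hpt
  rw [ex_smul, ex_condAvg] at hmono
  calc min (q j) (1 - q j) * (q i * (1 - q i) * ex (prodWeight q) (pivDiff i f * pivDiff i g))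
      = q i * (1 - q i) * (min (q j) (1 - q j) * ex (prodWeight q) (pivDiff i f * pivDiff i g)) := by ring
    _ ≤ q i * (1 - q i) * ex (prodWeight q) (condAvg q j (pivDiff i f) * condAvg q j (pivDiff i g)) :=
        mul_le_mul_of_nonneg_left hmono hqi

/-- The peeling sum inherits termwise lower bounds with a nonnegative factor. [this file] -/
theorem mul_peelSum_le_peelSum {q : ι → ℝ} (hq : ∀ i, 0 ≤ q i ∧ q i ≤ 1) {c : ℝ}
    {f g F G : (ι → Bool) → ℝ} (L : List ι)
    (hL : ∀ i ∈ L, c * coinfluence q i f g ≤ coinfluence q i F G) :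
    c * peelSum q f g L ≤ peelSum q F G L := by
  induction L with
  | nil => simp
  | cons j L ih =>
    rw [peelSum_cons, peelSum_cons, mul_add]
    have hj := hL j (by simp)
    have hrest := ih (fun i hi => hL i (by simp [hi]))
    have hm0 : 0 ≤ min (q j) (1 - q j) := le_min (hq j).1 (by linarith [(hq j).2])
    have : c * (min (q j) (1 - q j) * peelSum q f g L) ≤ min (q j) (1 - q j) * peelSum q F G L := by
      calc c * (min (q j) (1 - q j) * peelSum q f g L) = min (q j) (1 - q j) * (c * peelSum q f g L) := by ring
        _ ≤ min (q j) (1 - q j) * peelSum q F G L := mul_le_mul_of_nonneg_left hrest hm0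
    linarith

/-! ### Harris, and the main theorem -/

/-- Harris / FKG on the cube with a product weight: `E f·E g ≤ E(fg)` for nonnegative monotone `f, g`. [cite: Harris1960, Lemma 4.1 (p. 16)] -/
theorem cov_nonneg {q : ι → ℝ} (hq : ∀ i, 0 ≤ q i ∧ q i ≤ 1) {f g : (ι → Bool) → ℝ}
    (hf0 : ∀ x, 0 ≤ f x) (hg0 : ∀ x, 0 ≤ g x) (hf : Monotone f) (hg : Monotone g) :
    0 ≤ ex (prodWeight q) (f * g) - ex (prodWeight q) f * ex (prodWeight q) g := by
  have hFKG : IsFKGMeasure (prodWeight q) := isFKGMeasure_coinWeight (fun i => hq i)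
  linarith [ex_mul_ex_le_ex_mul hFKG hf0 hg0 hf hg]

/-- **Quantitative Harris by ordered peeling.**  For every list of distinct coordinates `j₁, …, j_k` and nonnegative monotone `f, g`:
`Σ_t (Π_{s<t} min(q_{j_s}, 1−q_{j_s})) · J_{j_t}(f,g) ≤ E(fg) − E f · E g`. [this file] -/
theorem peelSum_le_cov {q : ι → ℝ} (hq : ∀ i, 0 ≤ q i ∧ q i ≤ 1) :
    ∀ (L : List ι), L.Nodup → ∀ (f g : (ι → Bool) → ℝ), (∀ x, 0 ≤ f x) → (∀ x, 0 ≤ g x) → Monotone f → Monotone g →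
      peelSum q f g L ≤ ex (prodWeight q) (f * g) - ex (prodWeight q) f * ex (prodWeight q) g := by
  intro L
  induction L with
  | nil =>
    intro _ f g hf0 hg0 hf hg
    rw [peelSum_nil]
    exact cov_nonneg hq hf0 hg0 hf hg
  | cons j L ih =>
    intro hL f g hf0 hg0 hf hg
    have hjL : j ∉ L := (List.nodup_cons.mp hL).1
    have hL' : L.Nodup := (List.nodup_cons.mp hL).2
    rw [peelSum_cons, cov_eq_coinfluence_add_cov_condAvg q j f g]
    have hIH := ih hL' (condAvg q j f) (condAvg q j g) (condAvg_nonneg hq hf0 j) (condAvg_nonneg hq hg0 j)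
      (condAvg_mono hq hf j) (condAvg_mono hq hg j)
    have hstep : min (q j) (1 - q j) * peelSum q f g L ≤ peelSum q (condAvg q j f) (condAvg q j g) L :=
      mul_peelSum_le_peelSum hq L
        (fun i hi => min_mul_coinfluence_le_coinfluence_condAvg hq (ne_of_mem_of_not_mem hi hjL) hf hg)
    linarith

/-- The same with Sahi's `E₂`: `peelSum ≤ E₂(f,g)`. [this file] -/
theorem peelSum_le_sahiE_two {q : ι → ℝ} (hq : ∀ i, 0 ≤ q i ∧ q i ≤ 1) (L : List ι) (hL : L.Nodup)
    (f g : (ι → Bool) → ℝ) (hf0 : ∀ x, 0 ≤ f x) (hg0 : ∀ x, 0 ≤ g x) (hf : Monotone f) (hg : Monotone g) :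
    peelSum q f g L ≤ sahiE (prodWeight q) 2 ![f, g] := by
  rw [sahiE_two]
  exact peelSum_le_cov hq L hL f g hf0 hg0 hf hg

/-- **The explicit size constant**: `Σ_j J_j(f,g) ≤ |ι| · Cov(f,g)`, i.e. `Cov(f,g) ≥ (1/|E|)·Σ_e q_e(1−q_e)·E[Δ_e f·Δ_e g]`.
(Sum of the one-coordinate bounds; the «box size» enters only through `|E|`.) [this file] -/
theorem sum_coinfluence_le_card_mul_cov {q : ι → ℝ} (hq : ∀ i, 0 ≤ q i ∧ q i ≤ 1)
    (f g : (ι → Bool) → ℝ) (hf0 : ∀ x, 0 ≤ f x) (hg0 : ∀ x, 0 ≤ g x) (hf : Monotone f) (hg : Monotone g) :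
    ∑ j, coinfluence q j f g
      ≤ (Fintype.card ι : ℝ) * (ex (prodWeight q) (f * g) - ex (prodWeight q) f * ex (prodWeight q) g) := by
  have hj : ∀ j : ι, coinfluence q j f g ≤ ex (prodWeight q) (f * g) - ex (prodWeight q) f * ex (prodWeight q) g := by
    intro j
    have h := peelSum_le_cov hq [j] (List.nodup_singleton j) f g hf0 hg0 hf hg
    simpa using h
  calc ∑ j, coinfluence q j f g
      ≤ ∑ _j : ι, (ex (prodWeight q) (f * g) - ex (prodWeight q) f * ex (prodWeight q) g) := Finset.sum_le_sum fun j _ => hj j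
    _ = (Fintype.card ι : ℝ) * (ex (prodWeight q) (f * g) - ex (prodWeight q) f * ex (prodWeight q) g) := by
        rw [Finset.sum_const, nsmul_eq_mul, Finset.card_univ]

end QuantHarris

end Summit.CriticalPhenomena.PercolationContinuityZ3.Theorems
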